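import Summits.Ventures.LatticeQCDFlow.Scaling.TouchChainMoments

/-!
HONEST FRAMING: exact (Metropolis-corrected) sampling algorithms for lattice gauge theory; figures
of merit are autocorrelation/cost numbers at stated couplings and volumes; no continuum-physics
claim.

# CollectorFloor — THE COUPON-COLLECTOR FLOOR FOR ANY MIXTURE OF LOCAL MOVES: FROM A POINT MASS AT `x`,
# `(δ_x Pⁿ){z : z_k ≠ x_k ∀ k ∈ T} ≤ 1/s_n`, HENCE `d(n) ≥ 1 − 1/s_n − π{z : ∃ k ∈ T, z_k = x_k}`; WITH TOUCH RATES
# `θ_k ≤ θ` ON `T`: `s_n ≥ |T|(1−θ)ⁿ ≥ 1/η` FOR ALL `n ≤ ((1−θ)/θ)·log(|T|η)`, SO `t_mix(ε) > ((1−θ)/θ)·log(|T|η)`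
# WHENEVER `π{∃ k ∈ T, z_k = x_k} ≤ δ` AND `ε < 1 − η − δ` (lean-2 GEN-24, ours)

Venture-side (OURS).  Cell `lqcd-flow` (pub-lqcd), unit `pub-lqcd-lean-2-g24`, 2026-08-27.  Chapter L (the coupon-collector
law from a cold start), file 3: `Scaling/UntouchedReplicas` (the genealogical floor `(δ_x Pⁿ){all of T moved} ≤ (δ_T Rⁿ)(∅)`)
and `Scaling/TouchChainMoments` (`(δ_T Rⁿ)(∅) ≤ 1/s_n`, `s_n = Σ_{k∈T}(1−θ_k)ⁿ`, on a set `T` no move touches twice)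
assembled into total-variation and mixing-time floors, still for an ABSTRACT mixture `P = Σ_a c_a·Pm a` of local moves on
`L → S` (hypothesis-equations `hP`, `hR`; locality `k ∉ τ a, Pm a y z ≠ 0 ⇒ z_k = y_k`; `θ_k = Σ_{a : k ∈ τ a} c_a`) and
an arbitrary reference law `π` (a probability vector; stationary where the mixing time is concerned).

## What is proved

* §1 **`lawAt_allMoved_le_inv`** — `(δ_x Pⁿ){z : ∀ k ∈ T, z_k ≠ x_k} ≤ 1/s_n`; **`tvDist_lawAt_ge_collector`** —
  `‖δ_x Pⁿ − π‖_TV ≥ 1 − 1/s_n − π{z : ∃ k ∈ T, z_k = x_k}`; `worstTvDist_ge_collector` (`d(n) ≥` the same);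
  **`lt_mixingTime_of_collector`** — if `π` is stationary, the chain is `ε`-close at some time, and
  `1 − 1/s_n − π{∃ k ∈ T, z_k = x_k} > ε`, then `n < t_mix(ε)`.
* §2 uniform touch rates `θ_k ≤ θ < 1` on `T`: `touchSum_ge_card_mul_pow` (`s_n ≥ |T|(1−θ)ⁿ`),
  `one_sub_pow_ge_exp` (`(1−θ)ⁿ ≥ exp(−nθ/(1−θ))`), **`touchSum_ge_of_le_log`** — `n ≤ ((1−θ)/θ)·log(|T|η) ⇒ s_n ≥ 1/η`.
* §3 **`lt_mixingTime_of_le_log` (THE COUPON-COLLECTOR FLOOR)** — `θ_k ≤ θ` on an independent `T` (`0 < θ < 1`),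
  a start `x` with `π{∃ k ∈ T, z_k = x_k} ≤ δ`, `0 < η`, `ε < 1 − η − δ`, `π` stationary, the chain `ε`-close at some
  time: **every `n ≤ ((1−θ)/θ)·log(|T|η)` has `n < t_mix(ε)`**; **`mixingTime_ge_collector`** — as printed,
  **`t_mix(ε) ≥ ((1−θ)/θ)·log(|T|η)`**.

Reading (no numerics implied): a sampler built from local moves cannot be close to ANY law that gives small mass to the
initial values before its schedule has proposed every coordinate of `T`, which takes the coupon-collector time
`(1/θ)·log|T|` up to the factor `1 − θ` and the constants in the logarithm.  NOT CLAIMED: upper bounds; schedules that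
touch two coordinates of `T` in one move (then only the single-coordinate floor `(1−θ_k)ⁿ` survives).  Literature grade
(cell rule): KNOWN MECHANISM (Levin–Peres–Wilmer §7.3.1, Prop. 7.14's coupon-collector lower bound), NEW TYPING for
arbitrary local-move mixtures; nothing cited as a fact; no new bib keys.
-/

noncomputable section

open Finset Function
open Literature.Probability.MarkovChains

namespace Summit.Ventures.LatticeQCDFlow.Scaling

variable {S L ι : Type*} [Fintype S] [DecidableEq S] [Fintype L] [DecidableEq L] [Fintype ι]
  {c : ι → ℝ} {Pm : ι → (L → S) → (L → S) → ℝ} {τ : ι → Finset L}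
  {P : (L → S) → (L → S) → ℝ} {R : Finset L → Finset L → ℝ}

/-! ## §1 The floor with the coupon-collector estimate inserted -/

/-- **`(δ_x Pⁿ){z : ∀ k ∈ T, z_k ≠ x_k} ≤ 1/s_n`** on a set `T` no move touches twice, `s_n = Σ_{k∈T}(1−θ_k)ⁿ > 0`.
[ours] -/
theorem lawAt_allMoved_le_inv (hc : ∀ a, 0 ≤ c a) (hc1 : ∑ a, c a = 1)
    (hPm : ∀ a, IsRowStochastic (Pm a)) (hloc : ∀ a y z k, k ∉ τ a → Pm a y z ≠ 0 → z k = y k)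
    (hP : ∀ y z, P y z = ∑ a, c a * Pm a y z) (x : L → S) (T : Finset L)
    (hT : ∀ a, ∀ k ∈ T, ∀ l ∈ T, k ≠ l → ¬(k ∈ τ a ∧ l ∈ τ a)) (n : ℕ)
    (hs : 0 < ∑ k ∈ T, (1 - ∑ a ∈ univ.filter (fun a => k ∈ τ a), c a) ^ n) :
    ∑ z ∈ univ.filter (fun z : L → S => ∀ k ∈ T, z k ≠ x k), lawAt P (Pi.single x 1) n z
      ≤ 1 / ∑ k ∈ T, (1 - ∑ a ∈ univ.filter (fun a => k ∈ τ a), c a) ^ n := by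
  set R : Finset L → Finset L → ℝ := fun U V => ∑ a, c a * (if V = U \ τ a then (1 : ℝ) else 0) with hR_def
  have hR : ∀ U V, R U V = ∑ a, c a * (if V = U \ τ a then (1 : ℝ) else 0) := fun U V => rfl
  exact (lawAt_allMoved_le_touchEmpty hc hc1 hPm hloc hP hR x T n).trans (touch_lawAt_empty_le hc hc1 hR T hT n hs)

/-- **`‖δ_x Pⁿ − π‖_TV ≥ 1 − 1/s_n − π{z : ∃ k ∈ T, z_k = x_k}`** for every probability vector `π`. [ours] -/
theorem tvDist_lawAt_ge_collector (hc : ∀ a, 0 ≤ c a) (hc1 : ∑ a, c a = 1)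
    (hPm : ∀ a, IsRowStochastic (Pm a)) (hloc : ∀ a y z k, k ∉ τ a → Pm a y z ≠ 0 → z k = y k)
    (hP : ∀ y z, P y z = ∑ a, c a * Pm a y z) {π : (L → S) → ℝ} (hπ1 : ∑ z, π z = 1) (x : L → S) (T : Finset L)
    (hT : ∀ a, ∀ k ∈ T, ∀ l ∈ T, k ≠ l → ¬(k ∈ τ a ∧ l ∈ τ a)) (n : ℕ)
    (hs : 0 < ∑ k ∈ T, (1 - ∑ a ∈ univ.filter (fun a => k ∈ τ a), c a) ^ n) :
    1 - 1 / (∑ k ∈ T, (1 - ∑ a ∈ univ.filter (fun a => k ∈ τ a), c a) ^ n)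
        - ∑ z ∈ univ.filter (fun z : L → S => ∃ k ∈ T, z k = x k), π z
      ≤ tvDist (lawAt P (Pi.single x 1) n) π := by
  set R : Finset L → Finset L → ℝ := fun U V => ∑ a, c a * (if V = U \ τ a then (1 : ℝ) else 0) with hR_def
  have hR : ∀ U V, R U V = ∑ a, c a * (if V = U \ τ a then (1 : ℝ) else 0) := fun U V => rfl
  have hkept := lawAt_someKept_ge hc hc1 hPm hloc hP hR x T n
  have hempty := touch_lawAt_empty_le hc hc1 hR T hT n hs
  have hmass : ∑ z, lawAt P (Pi.single x 1) n z = ∑ z, π z := by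
    rw [sum_lawAt (mixture_isRowStochastic hc hc1 hPm hP), Finset.sum_pi_single', if_pos (mem_univ _), hπ1]
  have htv := sub_sum_le_tvDist hmass (univ.filter (fun z : L → S => ∃ k ∈ T, z k = x k))
  linarith

/-- `d(n) ≥ 1 − 1/s_n − π{z : ∃ k ∈ T, z_k = x_k}`. [ours] -/
theorem worstTvDist_ge_collector (hc : ∀ a, 0 ≤ c a) (hc1 : ∑ a, c a = 1)
    (hPm : ∀ a, IsRowStochastic (Pm a)) (hloc : ∀ a y z k, k ∉ τ a → Pm a y z ≠ 0 → z k = y k)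
    (hP : ∀ y z, P y z = ∑ a, c a * Pm a y z) {π : (L → S) → ℝ} (hπ1 : ∑ z, π z = 1) (x : L → S) (T : Finset L)
    (hT : ∀ a, ∀ k ∈ T, ∀ l ∈ T, k ≠ l → ¬(k ∈ τ a ∧ l ∈ τ a)) (n : ℕ)
    (hs : 0 < ∑ k ∈ T, (1 - ∑ a ∈ univ.filter (fun a => k ∈ τ a), c a) ^ n) :
    1 - 1 / (∑ k ∈ T, (1 - ∑ a ∈ univ.filter (fun a => k ∈ τ a), c a) ^ n)
        - ∑ z ∈ univ.filter (fun z : L → S => ∃ k ∈ T, z k = x k), π z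
      ≤ worstTvDist P π n :=
  (tvDist_lawAt_ge_collector hc hc1 hPm hloc hP hπ1 x T hT n hs).trans (tvDist_single_le_worstTvDist P π n x)

/-- **`n < t_mix(ε)`** as soon as `1 − 1/s_n − π{∃ k ∈ T, z_k = x_k} > ε`, for a stationary `π` and a chain that is
`ε`-close at some time. [ours] -/
theorem lt_mixingTime_of_collector (hc : ∀ a, 0 ≤ c a) (hc1 : ∑ a, c a = 1)
    (hPm : ∀ a, IsRowStochastic (Pm a)) (hloc : ∀ a y z k, k ∉ τ a → Pm a y z ≠ 0 → z k = y k)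
    (hP : ∀ y z, P y z = ∑ a, c a * Pm a y z) {π : (L → S) → ℝ} (hπ1 : ∑ z, π z = 1) (hst : IsStationary π P)
    (x : L → S) (T : Finset L) (hT : ∀ a, ∀ k ∈ T, ∀ l ∈ T, k ≠ l → ¬(k ∈ τ a ∧ l ∈ τ a)) (n : ℕ)
    (hs : 0 < ∑ k ∈ T, (1 - ∑ a ∈ univ.filter (fun a => k ∈ τ a), c a) ^ n) {ε : ℝ}
    (hε : ε < 1 - 1 / (∑ k ∈ T, (1 - ∑ a ∈ univ.filter (fun a => k ∈ τ a), c a) ^ n)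
        - ∑ z ∈ univ.filter (fun z : L → S => ∃ k ∈ T, z k = x k), π z)
    (hmix : ∃ t₀, worstTvDist P π t₀ ≤ ε) : n < mixingTime P π ε := by
  by_contra hn
  push Not at hn
  obtain ⟨t₀, ht₀⟩ := hmix
  have hd := worstTvDist_le_of_mixingTime_le (mixture_isRowStochastic hc hc1 hPm hP) hst ht₀ hn
  linarith [worstTvDist_ge_collector hc hc1 hPm hloc hP hπ1 x T hT n hs]

/-! ## §2 Uniform touch rates: `s_n ≥ |T|(1−θ)ⁿ ≥ 1/η` up to the coupon-collector time -/

omit [Fintype L] in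
/-- `θ_k ≤ θ ≤ 1` on `T` ⇒ `s_n ≥ |T|·(1−θ)ⁿ`. [ours] -/
theorem touchSum_ge_card_mul_pow (T : Finset L) {θ : ℝ} (hθ1 : θ ≤ 1)
    (hθ : ∀ k ∈ T, ∑ a ∈ univ.filter (fun a => k ∈ τ a), c a ≤ θ) (n : ℕ) :
    (T.card : ℝ) * (1 - θ) ^ n ≤ ∑ k ∈ T, (1 - ∑ a ∈ univ.filter (fun a => k ∈ τ a), c a) ^ n := by
  calc (T.card : ℝ) * (1 - θ) ^ n = ∑ _k ∈ T, (1 - θ) ^ n := by rw [sum_const, nsmul_eq_mul]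
    _ ≤ ∑ k ∈ T, (1 - ∑ a ∈ univ.filter (fun a => k ∈ τ a), c a) ^ n :=
        sum_le_sum fun k hk => pow_le_pow_left₀ (by linarith) (by linarith [hθ k hk]) n

omit [Fintype S] [DecidableEq S] [Fintype L] [DecidableEq L] [Fintype ι] in
/-- `(1−θ)ⁿ ≥ exp(−nθ/(1−θ))` for `θ < 1` (from `log(1−θ) ≥ 1 − 1/(1−θ)`). [ours] -/
theorem one_sub_pow_ge_exp {θ : ℝ} (hθ1 : θ < 1) (n : ℕ) :
    Real.exp (-(n * θ / (1 - θ))) ≤ (1 - θ) ^ n := by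
  have h1 : 0 < 1 - θ := by linarith
  have hlog : -(θ / (1 - θ)) ≤ Real.log (1 - θ) := by
    have := Real.one_sub_inv_le_log_of_pos h1
    have e : 1 - (1 - θ)⁻¹ = -(θ / (1 - θ)) := by field_simp; ring
    linarith
  calc Real.exp (-(n * θ / (1 - θ))) = Real.exp (n * -(θ / (1 - θ))) := by ring_nf
    _ ≤ Real.exp (n * Real.log (1 - θ)) := Real.exp_le_exp.mpr (mul_le_mul_of_nonneg_left hlog (Nat.cast_nonneg n))
    _ = (1 - θ) ^ n := by rw [← Real.log_pow, Real.exp_log (pow_pos h1 n)]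

omit [Fintype L] in
/-- **Up to the coupon-collector time the touch sum is large:** `T` non-empty, `θ_k ≤ θ` on `T` with `0 < θ < 1`,
`0 < η`, `n ≤ ((1−θ)/θ)·log(|T|·η)` ⇒ **`s_n ≥ 1/η`**. [ours] -/
theorem touchSum_ge_of_le_log (T : Finset L) (hTne : T.Nonempty) {θ η : ℝ} (hθ0 : 0 < θ) (hθ1 : θ < 1) (hη : 0 < η)
    (hθ : ∀ k ∈ T, ∑ a ∈ univ.filter (fun a => k ∈ τ a), c a ≤ θ) {n : ℕ}
    (hn : (n : ℝ) ≤ (1 - θ) / θ * Real.log (T.card * η)) :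
    1 / η ≤ ∑ k ∈ T, (1 - ∑ a ∈ univ.filter (fun a => k ∈ τ a), c a) ^ n := by
  have h1 : 0 < 1 - θ := by linarith
  have hTpos : (0 : ℝ) < T.card := Nat.cast_pos.mpr hTne.card_pos
  have hTη : 0 < (T.card : ℝ) * η := mul_pos hTpos hη
  have harg : (n : ℝ) * θ / (1 - θ) ≤ Real.log (T.card * η) := by
    have h := mul_le_mul_of_nonneg_left hn (div_pos hθ0 h1).le
    have e1 : θ / (1 - θ) * ((1 - θ) / θ * Real.log (T.card * η)) = Real.log (T.card * η) := by
      field_simp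
    have e2 : θ / (1 - θ) * (n : ℝ) = n * θ / (1 - θ) := by ring
    rw [e1, e2] at h
    exact h
  calc 1 / η = (T.card : ℝ) * Real.exp (-Real.log (T.card * η)) := by
        rw [Real.exp_neg, Real.exp_log hTη]; field_simp
    _ ≤ (T.card : ℝ) * Real.exp (-(n * θ / (1 - θ))) :=
        mul_le_mul_of_nonneg_left (Real.exp_le_exp.mpr (neg_le_neg harg)) hTpos.le
    _ ≤ (T.card : ℝ) * (1 - θ) ^ n := mul_le_mul_of_nonneg_left (one_sub_pow_ge_exp hθ1 n) hTpos.le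
    _ ≤ ∑ k ∈ T, (1 - ∑ a ∈ univ.filter (fun a => k ∈ τ a), c a) ^ n := touchSum_ge_card_mul_pow T hθ1.le hθ n

/-! ## §3 The coupon-collector floor on the mixing time -/

/-- **THE COUPON-COLLECTOR FLOOR:** `θ_k ≤ θ` on a non-empty set `T` no move touches twice (`0 < θ < 1`), a start `x`
whose initial values are rare for `π` on `T` (`π{z : ∃ k ∈ T, z_k = x_k} ≤ δ`), `0 < η`, `ε < 1 − η − δ`, `π` stationary,
the chain `ε`-close at some time: **every `n ≤ ((1−θ)/θ)·log(|T|·η)` has `n < t_mix(ε)`**. [ours] -/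
theorem lt_mixingTime_of_le_log (hc : ∀ a, 0 ≤ c a) (hc1 : ∑ a, c a = 1)
    (hPm : ∀ a, IsRowStochastic (Pm a)) (hloc : ∀ a y z k, k ∉ τ a → Pm a y z ≠ 0 → z k = y k)
    (hP : ∀ y z, P y z = ∑ a, c a * Pm a y z) {π : (L → S) → ℝ} (hπ1 : ∑ z, π z = 1) (hst : IsStationary π P)
    (x : L → S) (T : Finset L) (hT : ∀ a, ∀ k ∈ T, ∀ l ∈ T, k ≠ l → ¬(k ∈ τ a ∧ l ∈ τ a)) (hTne : T.Nonempty)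
    {θ η δ ε : ℝ} (hθ0 : 0 < θ) (hθ1 : θ < 1) (hη : 0 < η)
    (hθ : ∀ k ∈ T, ∑ a ∈ univ.filter (fun a => k ∈ τ a), c a ≤ θ)
    (hδ : ∑ z ∈ univ.filter (fun z : L → S => ∃ k ∈ T, z k = x k), π z ≤ δ) (hgap : ε < 1 - η - δ)
    (hmix : ∃ t₀, worstTvDist P π t₀ ≤ ε) {n : ℕ} (hn : (n : ℝ) ≤ (1 - θ) / θ * Real.log (T.card * η)) :
    n < mixingTime P π ε := by
  have hsge := touchSum_ge_of_le_log (c := c) (τ := τ) T hTne hθ0 hθ1 hη hθ hn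
  have hspos : 0 < ∑ k ∈ T, (1 - ∑ a ∈ univ.filter (fun a => k ∈ τ a), c a) ^ n :=
    lt_of_lt_of_le (by positivity) hsge
  refine lt_mixingTime_of_collector hc hc1 hPm hloc hP hπ1 hst x T hT n hspos ?_ hmix
  have h1s : 1 / (∑ k ∈ T, (1 - ∑ a ∈ univ.filter (fun a => k ∈ τ a), c a) ^ n) ≤ η := by
    rw [one_div_le hspos hη]; exact hsge
  linarith

/-- **THE COUPON-COLLECTOR FLOOR, as printed:** under the same hypotheses,
**`t_mix(ε) ≥ ((1−θ)/θ)·log(|T|·η)`**. [ours] -/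
theorem mixingTime_ge_collector (hc : ∀ a, 0 ≤ c a) (hc1 : ∑ a, c a = 1)
    (hPm : ∀ a, IsRowStochastic (Pm a)) (hloc : ∀ a y z k, k ∉ τ a → Pm a y z ≠ 0 → z k = y k)
    (hP : ∀ y z, P y z = ∑ a, c a * Pm a y z) {π : (L → S) → ℝ} (hπ1 : ∑ z, π z = 1) (hst : IsStationary π P)
    (x : L → S) (T : Finset L) (hT : ∀ a, ∀ k ∈ T, ∀ l ∈ T, k ≠ l → ¬(k ∈ τ a ∧ l ∈ τ a)) (hTne : T.Nonempty)
    {θ η δ ε : ℝ} (hθ0 : 0 < θ) (hθ1 : θ < 1) (hη : 0 < η)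
    (hθ : ∀ k ∈ T, ∑ a ∈ univ.filter (fun a => k ∈ τ a), c a ≤ θ)
    (hδ : ∑ z ∈ univ.filter (fun z : L → S => ∃ k ∈ T, z k = x k), π z ≤ δ) (hgap : ε < 1 - η - δ)
    (hmix : ∃ t₀, worstTvDist P π t₀ ≤ ε) :
    (1 - θ) / θ * Real.log (T.card * η) ≤ (mixingTime P π ε : ℝ) := by
  by_contra h
  push Not at h
  exact lt_irrefl _ (lt_mixingTime_of_le_log hc hc1 hPm hloc hP hπ1 hst x T hT hTne hθ0 hθ1 hη hθ hδ hgap hmix h.le)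

end Summit.Ventures.LatticeQCDFlow.Scaling

end
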